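import Summits.RiemannHypothesis.RiemannHypothesis.Theorems.WeilGroundStateGroundStatesConvergeToXiEnergyUpperTail
import Literature.NumberTheory.LFunctions.WeilExplicitProofs
import Literature.NumberTheory.LFunctions.WeilWindowSuzukiProofs
import HarnessLib

/-!
# `WeilGroundState.GroundStatesConvergeToXi` — a super-exponential UPPER bound for Weil's ground energy
(crux item stmt-RiemannHypothesis-1527, route route-RiemannHypothesis-WeilGroundState; line `Sketch`,
lead c2; `--supports`: RH-free facts about the energy side of the open stub `stub_tightWeakLimit`)

Main result (RH-free): `weilGroundEnergy_le_superexp` —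
there is `C` with `ε(a) = weilGroundEnergy a ≤ C · exp(−(π/2) e^{2(a−1)})` for every window `a ≥ 2`.

Proof.  Truncate Riemann's kernel `Φ(t) = 2Ψ(2t)` (`LagariasMontague.Psic`; `Φ̂ = weilMellin Φ = ξ`,
`stub_mellinXi`) with the tree's plateau cutoff `χ_a = Literature.Analysis.Calculus.cutoff a`
(`= 1` on `[−(a−1), a−1]`, `= 0` off `(−a, a)`): `φ_a := Φ χ_a` is a Weil test function on
`[−a, a]` (`isWeilTest_phiCut`), so `ε(a) ≤ Re Q(φ_a)/‖φ_a‖₂²` (`weilGroundEnergy_le_div`), and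
`‖φ_a‖₂² ≥ N₀ > 0` for `a ≥ 2`.  By the explicit formula (`explicit_formula_holds`, absolutely
convergent zero side `hasWeilZeroSide_tsum`) and `(g ⋆ g̃)^ = ĝ · conj ĝ(1 − conj ·)`,
`Q(φ_a) = Σ_ρ m(ρ) φ̂_a(ρ) conj φ̂_a(1−ρ̄)`; since `ξ` VANISHES at the non-trivial zeros,
`φ̂_a(ρ) = ξ(ρ) − (Φ(1−χ_a))^(ρ) = −(Φ(1−χ_a))^(ρ)` is the transform of the TAIL of the kernel,
which is `≤ D exp(−(π/4)e^{2(a−1)})/(1+γ²)` in the closed strip by two integrations by parts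
(`norm_weilMellin_le_of_two_derivs`, file `…MellinByParts`) and the double-exponential envelope of
`Φ, Φ', Φ''` (file `…PhiTail`); summing against `Σ_ρ m(ρ)/(1+γ²)² < ∞` (`weilZeroSummable`)
gives `‖Q(φ_a)‖ ≤ D² Z₀ exp(−(π/2)e^{2(a−1)})`.

Consequences (file `…EnergyLimit`): `limsup_{a→∞} ε(a) ≤ 0` unconditionally; under RH
`0 ≤ ε(a) → 0`; `RH ⟺ ε(a) → 0` and `¬RH ⟺ ε(a) → −∞` (with `riemannHypothesis_iff_weilGroundEnergy_bddBelow`).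
Relevance to the crux: under RH the truncated kernel `φ_a` is a quasimode of energy
`≤ C exp(−(π/2)e^{2(a−1)})`, the limit energy in the Euler–Lagrange equation of tight weak limits of
renormalised ground states is `ε_∞ = 0` (Weil-harmonicity of limits), and any "quasimode + spectral
gap ⇒ C⁺" argument has this defect scale to beat.  No new definitions (all objects inline).
-/

noncomputable section

set_option linter.dupNamespace false

open scoped Topology Real ComplexConjugate
open Filter Set MeasureTheory Complex

namespace Summit.RiemannHypothesis.RiemannHypothesis.Theorems.GroundStatesConvergeToXi

open Literature.NumberTheory.LFunctions

/-! ## The energy of the truncated kernel via the explicit formula -/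

/-- **`Q(φ_a)` is double-exponentially small**: there is `C ≥ 0` with
`‖weilQuadratic φ_a‖ ≤ C exp(−(π/2)e^{2(a−1)})` for all `a ≥ 1`.  By the explicit formula
(`explicit_formula_holds`, absolutely convergent zero side) `Q(φ_a) = Σ_ρ m(ρ) φ̂_a(ρ) conj φ̂_a(1−ρ̄)`,
and both factors are tail transforms at zeros of `ξ`. RH-free. [folklore] -/
theorem exists_norm_weilQuadratic_phiCut_le :
    ∃ C : ℝ, 0 ≤ C ∧ ∀ a : ℝ, 1 ≤ a →
      ‖weilQuadratic (fun t : ℝ => (2 : ℂ) * LagariasMontague.Psic (2 * t) *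
          ((Literature.Analysis.Calculus.cutoff a t : ℝ) : ℂ))‖ ≤
        C * Real.exp (-(π / 2 * Real.exp (2 * (a - 1)))) := by
  obtain ⟨D, hD, hZ⟩ := exists_norm_weilMellin_phiCut_zero_le
  set Z₀ : ℝ := ∑' ρ : ZetaZeros.riemannZetaNontrivialZeros, weilZeroWeight (ρ : ℂ) with hZ₀
  have hZ₀0 : 0 ≤ Z₀ := tsum_nonneg fun ρ => weilZeroWeight_nonneg ρ.2
  refine ⟨D ^ 2 * Z₀, by positivity, fun a ha => ?_⟩
  set φ : ℝ → ℂ := fun t : ℝ => (2 : ℂ) * LagariasMontague.Psic (2 * t) *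
    ((Literature.Analysis.Calculus.cutoff a t : ℝ) : ℂ) with hφdef
  set η : ℝ := Real.exp (-(π / 4 * Real.exp (2 * (a - 1)))) with hη
  have hη2 : Real.exp (-(π / 2 * Real.exp (2 * (a - 1)))) = η ^ 2 := by
    rw [hη, ← Real.exp_nat_mul]; congr 1; push_cast; ring
  have hφ : IsWeilTest φ := isWeilTest_phiCut a
  have hφr : IsWeilTest (weilReflect φ) := hφ.weilReflect
  have hk : IsWeilTest (weilConv φ (weilReflect φ)) := hφ.weilConv hφr
  -- explicit formula, absolutely convergent form
  have hsum := summable_norm_zeroSide hk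
  have hW : weilQuadratic φ = ∑' ρ : ZetaZeros.riemannZetaNontrivialZeros,
      (riemannZetaZeroOrder (ρ : ℂ) : ℂ) * weilMellin (weilConv φ (weilReflect φ)) ρ :=
    tendsto_nhds_unique (explicit_formula_holds hk) (hasWeilZeroSide_tsum hsum)
  -- termwise bound
  have hterm : ∀ ρ : ZetaZeros.riemannZetaNontrivialZeros,
      ‖(riemannZetaZeroOrder (ρ : ℂ) : ℂ) * weilMellin (weilConv φ (weilReflect φ)) ρ‖ ≤
        D ^ 2 * η ^ 2 * weilZeroWeight (ρ : ℂ) := by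
    intro ρ
    have hρ := ρ.2
    have hρ' := ZetaZeros.riemannZetaNontrivialZeros.one_sub_conj_mem hρ
    have hm : (0 : ℝ) ≤ riemannZetaZeroOrder (ρ : ℂ) := by
      exact_mod_cast riemannZetaZeroOrder_nonneg (ZetaZeros.riemannZetaNontrivialZeros.ne_one hρ)
    rw [weilMellin_weilConv_holds hφ.1.continuous hφ.2 hφr.1.continuous hφr.2,
      weilMellin_weilReflect_holds φ ρ, norm_mul, norm_mul, Complex.norm_intCast, abs_of_nonneg hm,
      Complex.norm_conj]
    have hA := hZ a ha ρ hρ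
    have hB := hZ a ha (1 - conj (ρ : ℂ)) hρ'
    have him : (1 - conj (ρ : ℂ)).im = (ρ : ℂ).im := by simp
    rw [him] at hB
    have hpos : 0 < 1 + (ρ : ℂ).im ^ 2 := by positivity
    rw [weilZeroWeight]
    calc (riemannZetaZeroOrder (ρ : ℂ) : ℝ) * (‖weilMellin φ ρ‖ * ‖weilMellin φ (1 - conj (ρ : ℂ))‖)
        ≤ (riemannZetaZeroOrder (ρ : ℂ) : ℝ) * ((D * η / (1 + (ρ : ℂ).im ^ 2)) * (D * η / (1 + (ρ : ℂ).im ^ 2))) :=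
          mul_le_mul_of_nonneg_left (mul_le_mul hA hB (norm_nonneg _) (by positivity)) hm
      _ = D ^ 2 * η ^ 2 * ((riemannZetaZeroOrder (ρ : ℂ) : ℝ) / (1 + (ρ : ℂ).im ^ 2) ^ 2) := by
          field_simp
  have hsum' : Summable fun ρ : ZetaZeros.riemannZetaNontrivialZeros => D ^ 2 * η ^ 2 * weilZeroWeight (ρ : ℂ) :=
    weilZeroSummable.mul_left _
  rw [hW, hη2]
  calc ‖∑' ρ : ZetaZeros.riemannZetaNontrivialZeros,
        (riemannZetaZeroOrder (ρ : ℂ) : ℂ) * weilMellin (weilConv φ (weilReflect φ)) ρ‖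
      ≤ ∑' ρ : ZetaZeros.riemannZetaNontrivialZeros,
        ‖(riemannZetaZeroOrder (ρ : ℂ) : ℂ) * weilMellin (weilConv φ (weilReflect φ)) ρ‖ :=
        norm_tsum_le_tsum_norm hsum
    _ ≤ ∑' ρ : ZetaZeros.riemannZetaNontrivialZeros, D ^ 2 * η ^ 2 * weilZeroWeight (ρ : ℂ) :=
        hsum.tsum_le_tsum hterm hsum'
    _ = D ^ 2 * η ^ 2 * Z₀ := by rw [tsum_mul_left]
    _ = D ^ 2 * Z₀ * η ^ 2 := by ring

/-- **The truncated Riemann kernel is an APPROXIMATE WEIL-HARMONIC function (RH-free).**  There is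
`D ≥ 0` such that for every test function `g` and every `a ≥ 1`,
`‖W(φ_a ⋆ g̃)‖ ≤ D · C_g · exp(−(π/4)e^{2(a−1)})` with `C_g = weilDecayConst g`
(`= ∫‖g‖e^{|t|/2} + ∫‖g''‖e^{|t|/2}`).  Indeed `W(φ_a ⋆ g̃) = Σ_ρ m(ρ) φ̂_a(ρ) conj ĝ(1−ρ̄)` by the
explicit formula, `φ̂_a(ρ)` is the tail transform at a zero of `ξ`, and `‖ĝ(1−ρ̄)‖ ≤ C_g/(1+γ²)`.
Compare the exact Euler–Lagrange identity `W(u_a ⋆ g̃) = ε(a)⟨u_a, g⟩` of a ground state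
(`groundState_eulerLagrange`): the trial state `φ_a` satisfies the same weak equation up to a
double-exponentially small error, with "eigenvalue" `0`. [folklore] -/
theorem exists_norm_weilFunctional_phiCut_weilConv_le :
    ∃ D : ℝ, 0 ≤ D ∧ ∀ g : ℝ → ℂ, IsWeilTest g → ∀ a : ℝ, 1 ≤ a →
      ‖weilFunctional (weilConv (fun t : ℝ => (2 : ℂ) * LagariasMontague.Psic (2 * t) *
          ((Literature.Analysis.Calculus.cutoff a t : ℝ) : ℂ)) (weilReflect g))‖ ≤
        D * weilDecayConst g * Real.exp (-(π / 4 * Real.exp (2 * (a - 1)))) := by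
  obtain ⟨D, hD, hZ⟩ := exists_norm_weilMellin_phiCut_zero_le
  set Z₀ : ℝ := ∑' ρ : ZetaZeros.riemannZetaNontrivialZeros, weilZeroWeight (ρ : ℂ) with hZ₀
  have hZ₀0 : 0 ≤ Z₀ := tsum_nonneg fun ρ => weilZeroWeight_nonneg ρ.2
  refine ⟨D * Z₀, by positivity, fun g hg a ha => ?_⟩
  set φ : ℝ → ℂ := fun t : ℝ => (2 : ℂ) * LagariasMontague.Psic (2 * t) *
    ((Literature.Analysis.Calculus.cutoff a t : ℝ) : ℂ) with hφdef
  set η : ℝ := Real.exp (-(π / 4 * Real.exp (2 * (a - 1)))) with hη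
  have hφ : IsWeilTest φ := isWeilTest_phiCut a
  have hgr : IsWeilTest (weilReflect g) := hg.weilReflect
  have hk : IsWeilTest (weilConv φ (weilReflect g)) := hφ.weilConv hgr
  have hsum := summable_norm_zeroSide hk
  have hW : weilFunctional (weilConv φ (weilReflect g)) = ∑' ρ : ZetaZeros.riemannZetaNontrivialZeros,
      (riemannZetaZeroOrder (ρ : ℂ) : ℂ) * weilMellin (weilConv φ (weilReflect g)) ρ :=
    tendsto_nhds_unique (explicit_formula_holds hk) (hasWeilZeroSide_tsum hsum)
  have hCg : 0 ≤ weilDecayConst g := weilDecayConst_nonneg g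
  have hterm : ∀ ρ : ZetaZeros.riemannZetaNontrivialZeros,
      ‖(riemannZetaZeroOrder (ρ : ℂ) : ℂ) * weilMellin (weilConv φ (weilReflect g)) ρ‖ ≤
        D * weilDecayConst g * η * weilZeroWeight (ρ : ℂ) := by
    intro ρ
    have hρ := ρ.2
    have hρ' := ZetaZeros.riemannZetaNontrivialZeros.one_sub_conj_mem hρ
    have hm : (0 : ℝ) ≤ riemannZetaZeroOrder (ρ : ℂ) := by
      exact_mod_cast riemannZetaZeroOrder_nonneg (ZetaZeros.riemannZetaNontrivialZeros.ne_one hρ)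
    rw [weilMellin_weilConv_holds hφ.1.continuous hφ.2 hgr.1.continuous hgr.2,
      weilMellin_weilReflect_holds g ρ, norm_mul, norm_mul, Complex.norm_intCast, abs_of_nonneg hm,
      Complex.norm_conj]
    have hA := hZ a ha ρ hρ
    have hB : ‖weilMellin g (1 - conj (ρ : ℂ))‖ ≤ weilDecayConst g / (1 + (ρ : ℂ).im ^ 2) := by
      have h := norm_weilMellin_le hg (ZetaZeros.riemannZetaNontrivialZeros.re_pos hρ').le
        (ZetaZeros.riemannZetaNontrivialZeros.re_lt_one hρ').le
      have him : (1 - conj (ρ : ℂ)).im = (ρ : ℂ).im := by simp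
      rwa [him] at h
    have hpos : 0 < 1 + (ρ : ℂ).im ^ 2 := by positivity
    rw [weilZeroWeight]
    calc (riemannZetaZeroOrder (ρ : ℂ) : ℝ) * (‖weilMellin φ ρ‖ * ‖weilMellin g (1 - conj (ρ : ℂ))‖)
        ≤ (riemannZetaZeroOrder (ρ : ℂ) : ℝ) * ((D * η / (1 + (ρ : ℂ).im ^ 2)) *
            (weilDecayConst g / (1 + (ρ : ℂ).im ^ 2))) :=
          mul_le_mul_of_nonneg_left (mul_le_mul hA hB (norm_nonneg _) (by positivity)) hm
      _ = D * weilDecayConst g * η * ((riemannZetaZeroOrder (ρ : ℂ) : ℝ) / (1 + (ρ : ℂ).im ^ 2) ^ 2) := by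
          field_simp
  have hsum' : Summable fun ρ : ZetaZeros.riemannZetaNontrivialZeros =>
      D * weilDecayConst g * η * weilZeroWeight (ρ : ℂ) := weilZeroSummable.mul_left _
  rw [hW]
  calc ‖∑' ρ : ZetaZeros.riemannZetaNontrivialZeros,
        (riemannZetaZeroOrder (ρ : ℂ) : ℂ) * weilMellin (weilConv φ (weilReflect g)) ρ‖
      ≤ ∑' ρ : ZetaZeros.riemannZetaNontrivialZeros,
        ‖(riemannZetaZeroOrder (ρ : ℂ) : ℂ) * weilMellin (weilConv φ (weilReflect g)) ρ‖ :=
        norm_tsum_le_tsum_norm hsum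
    _ ≤ ∑' ρ : ZetaZeros.riemannZetaNontrivialZeros, D * weilDecayConst g * η * weilZeroWeight (ρ : ℂ) :=
        hsum.tsum_le_tsum hterm hsum'
    _ = D * weilDecayConst g * η * Z₀ := by rw [tsum_mul_left]
    _ = D * Z₀ * weilDecayConst g * η := by ring

/-! ## The super-exponential upper bound for the ground energy -/

/-- **Uniform lower bound for `‖φ_a‖₂²`, `a ≥ 2`**: `∫‖φ_a‖² ≥ N₀ := ∫ ‖Φ‖² χ_1 > 0`
(on `[-1,1]` the cutoff `χ_a` is `1`; `Φ(0) = 2Ψ(0) > 0`). [folklore] -/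
theorem exists_integral_norm_sq_phiCut_ge :
    ∃ N₀ : ℝ, 0 < N₀ ∧ ∀ a : ℝ, 2 ≤ a → N₀ ≤ ∫ t : ℝ, ‖(2 : ℂ) * LagariasMontague.Psic (2 * t) *
      ((Literature.Analysis.Calculus.cutoff a t : ℝ) : ℂ)‖ ^ 2 := by
  set g : ℝ → ℝ := fun t => ‖(2 : ℂ) * LagariasMontague.Psic (2 * t)‖ ^ 2 *
    Literature.Analysis.Calculus.cutoff 1 t with hgdef
  have hgc : Continuous g := (continuous_phi.norm.pow 2).mul
    (Literature.Analysis.Calculus.contDiff_cutoff 1 (n := 0)).continuous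
  have hgs : HasCompactSupport g := by
    refine HasCompactSupport.intro (isCompact_Icc (a := -1) (b := 1)) fun t ht => ?_
    have hta : 1 ≤ |t| := by
      simp only [mem_Icc, not_and_or, not_le] at ht
      rcases ht with h | h
      · linarith [neg_abs_le t]
      · linarith [le_abs_self t]
    simp [hgdef, Literature.Analysis.Calculus.cutoff_eq_zero hta]
  have hg0 : 0 ≤ g := fun t => mul_nonneg (sq_nonneg _) (Literature.Analysis.Calculus.cutoff_nonneg 1 t)
  have hgpt : g 0 ≠ 0 := by
    have h1 : Literature.Analysis.Calculus.cutoff 1 0 = 1 :=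
      Literature.Analysis.Calculus.cutoff_eq_one (by simp)
    have h2 : ‖(2 : ℂ) * LagariasMontague.Psic (2 * 0)‖ ≠ 0 := by
      rw [norm_phi, mul_zero]
      exact mul_ne_zero two_ne_zero (abs_pos.2 LagariasMontague.Psi_zero_pos.ne').ne'
    simp only [hgdef, h1, mul_one]
    exact pow_ne_zero 2 h2
  refine ⟨∫ t, g t, hgc.integral_pos_of_hasCompactSupport_nonneg_nonzero hgs hg0 hgpt, fun a ha => ?_⟩
  have hφ := isWeilTest_phiCut a
  have hcs : HasCompactSupport fun t : ℝ => ‖(2 : ℂ) * LagariasMontague.Psic (2 * t) *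
      ((Literature.Analysis.Calculus.cutoff a t : ℝ) : ℂ)‖ ^ 2 := by
    have h := hφ.2.norm.mul_right (f' := fun t : ℝ => ‖(2 : ℂ) * LagariasMontague.Psic (2 * t) *
      ((Literature.Analysis.Calculus.cutoff a t : ℝ) : ℂ)‖)
    have e : (fun t : ℝ => ‖(2 : ℂ) * LagariasMontague.Psic (2 * t) *
        ((Literature.Analysis.Calculus.cutoff a t : ℝ) : ℂ)‖ ^ 2) =
        (fun t : ℝ => ‖(2 : ℂ) * LagariasMontague.Psic (2 * t) *
          ((Literature.Analysis.Calculus.cutoff a t : ℝ) : ℂ)‖) * fun t : ℝ =>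
          ‖(2 : ℂ) * LagariasMontague.Psic (2 * t) * ((Literature.Analysis.Calculus.cutoff a t : ℝ) : ℂ)‖ := by
      funext t
      simp [pow_two]
    rw [e]
    exact h
  refine integral_mono (hgc.integrable_of_hasCompactSupport hgs)
    ((hφ.1.continuous.norm.pow 2).integrable_of_hasCompactSupport hcs) fun t => ?_
  simp only [hgdef]
  rw [norm_phiCut, mul_pow]
  by_cases ht : 1 ≤ |t|
  · rw [Literature.Analysis.Calculus.cutoff_eq_zero ht, mul_zero]
    positivity
  · rw [Literature.Analysis.Calculus.cutoff_eq_one (show |t| ≤ a - 1 by linarith [not_le.1 ht]), one_pow,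
      mul_one]
    exact mul_le_of_le_one_right (sq_nonneg _) (Literature.Analysis.Calculus.cutoff_le_one 1 t)

/-- **SUPER-EXPONENTIAL UPPER BOUND FOR THE GROUND ENERGY (RH-free).** There is a constant `C`
such that for every window `a ≥ 2`,
`weilGroundEnergy a ≤ C · exp(−(π/2) e^{2(a−1)})`.
Proof: the truncated Riemann kernel `φ_a = Φχ_a` is a test function on `[-a,a]`, so
`ε(a) ≤ Re Q(φ_a)/‖φ_a‖² ≤ ‖Q(φ_a)‖/N₀` (`weilGroundEnergy_le_div`); and by the explicit formula
`Q(φ_a) = Σ_ρ m(ρ) φ̂_a(ρ) conj φ̂_a(1−ρ̄)` where, since `Φ̂ = ξ` vanishes at the zeros, both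
factors are transforms of the TAIL `Φ(1−χ_a)`, of size `O(exp(−(π/4)e^{2(a−1)})/(1+γ²))`.
Consequences (file `…EnergyLimit`): `limsup_{a→∞} ε(a) ≤ 0` unconditionally, and
`RH ⟺ ε(a) → 0` (under RH `0 ≤ ε(a)`), complementing `RH ⟺ ε bounded below`. [folklore] -/
theorem weilGroundEnergy_le_superexp :
    ∃ C : ℝ, 0 ≤ C ∧ ∀ a : ℝ, 2 ≤ a →
      weilGroundEnergy a ≤ C * Real.exp (-(π / 2 * Real.exp (2 * (a - 1)))) := by
  obtain ⟨C, hC, hQ⟩ := exists_norm_weilQuadratic_phiCut_le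
  obtain ⟨N₀, hN₀, hN⟩ := exists_integral_norm_sq_phiCut_ge
  refine ⟨C / N₀, by positivity, fun a ha => ?_⟩
  set φ : ℝ → ℂ := fun t : ℝ => (2 : ℂ) * LagariasMontague.Psic (2 * t) *
    ((Literature.Analysis.Calculus.cutoff a t : ℝ) : ℂ) with hφdef
  have hpos : 0 < ∫ t : ℝ, ‖φ t‖ ^ 2 := hN₀.trans_le (hN a ha)
  have h1 : weilGroundEnergy a ≤ (weilQuadratic φ).re / ∫ t : ℝ, ‖φ t‖ ^ 2 :=
    weilGroundEnergy_le_div (isWeilTest_phiCut a) (tsupport_phiCut_subset a) hpos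
  have h2 : (weilQuadratic φ).re ≤ C * Real.exp (-(π / 2 * Real.exp (2 * (a - 1)))) :=
    (Complex.re_le_norm _).trans (hQ a (by linarith))
  have h3 : (weilQuadratic φ).re / ∫ t : ℝ, ‖φ t‖ ^ 2 ≤
      C * Real.exp (-(π / 2 * Real.exp (2 * (a - 1)))) / N₀ := by
    rcases le_or_gt 0 (weilQuadratic φ).re with hq | hq
    · exact div_le_div₀ (by positivity) h2 hN₀ (hN a ha)
    · exact (div_neg_of_neg_of_pos hq hpos).le.trans (by positivity)
  calc weilGroundEnergy a ≤ _ := h1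
    _ ≤ _ := h3
    _ = C / N₀ * Real.exp (-(π / 2 * Real.exp (2 * (a - 1)))) := by ring

end Summit.RiemannHypothesis.RiemannHypothesis.Theorems.GroundStatesConvergeToXi

end
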